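import Summits.AtomisticToContinuum.Crystallization.Theorems.FreeSplittingCertificatesStrictSplittingRuleFarPencilFlux4Radial
import Summits.AtomisticToContinuum.Crystallization.Theorems.FreeSplittingCertificatesStrictSplittingRuleFarPencilFlux4LocallyAffine

/-!
# `StrictSplittingRule` (stmt-AtomisticToContinuum-12560): the SPLIT WEIGHT of the near/far architecture is an admissible `C²` weight — quintic smoothstep in `|x|²`

Route `FreeSplittingCertificates`, crux r3 `StrictSplittingRule` (H12⋆ = `stub_coreJointCoercive`), unit b2b-freesplit-B gen 18.
VALUE = a kernel brick the assembly needs on BOTH sides of the split: the weight actually used by the certificate-form near ledger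
(`nearcert.py`/`boxnear.py`, HOME CERT.md §20–§24: `χ(x) = S((|x|² − R₁²)/(R₂² − R₁²))`, `S` = the quintic smoothstep `t³(10 − 15t + 6t²)`
glued with `0` and `1`; far weight `χ²`, near weight `1 − χ²`, flux weight `4χ·dχ/ds`) satisfies the three weight hypotheses of every
weighted far theorem of the tree (`…FarPencilWeighted*`, `…GrowthIntegral`, `…LocallyAffine`, `…Flux4*`): `χ ∈ C²`, `0 ∉ tsupport χ`,
`χ = 1` outside a ball.  NOT a proof of H12⋆, NOT summit progress.

* `fpSmoothstep`, `fpSmoothstep1`, `fpSmoothstep2` — `S`, `S′ = 30t²(1−t)²`, `S″ = 60t(1−t)(1−2t)` glued with `0` outside `[0,1]`;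
  `hasDerivAt_fpSmoothstep`, `hasDerivAt_fpSmoothstep1` (gluing at `0` and `1` by one-sided derivatives), `continuous_fpSmoothstep2`,
  **`contDiff_two_fpSmoothstep : ContDiff ℝ 2 fpSmoothstep`**;
* `fpChi S₁ S₂ x = S((|x|² − S₁)/(S₂ − S₁))`: **`contDiff_two_fpChi`**, **`zero_notMem_tsupport_fpChi`** (`0 < S₁ < S₂`),
  **`fpChi_eq_one_of_norm_ge`** (`S₂ ≤ R²`), `fpGradS_fpChi` (`∂ⱼχ = 2xⱼ·S′(t)/(S₂ − S₁)` — the ledger's `dchi/ds`),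
  `two_chi_fpFlux4DotGrad_fpChi` (the interface density of the generic flux against this weight = the ledger's three flux channels);
* `farPencilD_weighted_integral_le_fpChi`: certificate D on the P1 class with `χ = fpChi R₁² R₂²`, all weight hypotheses discharged.
HONEST FRAMING: elementary calculus about an explicit piecewise-polynomial weight; NOT a proof of H12⋆, NOT summit progress.
-/

noncomputable section

open MeasureTheory Topology Filter Set Metric
open scoped NNReal

namespace Summit.AtomisticToContinuum.Crystallization.Theorems.StrictSplittingRuleBirth

/-- The quintic smoothstep glued with `0` below `0` and `1` above `1`: `S(t) = 0` (`t ≤ 0`), `t³(10 − 15t + 6t²)` (`0 ≤ t ≤ 1`), `1` (`t ≥ 1`)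
(the near ledger's `smooth`, `nearcert.py`). -/
def fpSmoothstep (t : ℝ) : ℝ :=
  if t ≤ 0 then 0 else if 1 ≤ t then 1 else t ^ 3 * (10 - 15 * t + 6 * t ^ 2)

/-- Its derivative `S′(t) = 30t²(1−t)²` on `[0,1]`, `0` outside. -/
def fpSmoothstep1 (t : ℝ) : ℝ :=
  if t ≤ 0 then 0 else if 1 ≤ t then 0 else 30 * t ^ 2 * (1 - t) ^ 2

/-- Its second derivative `S″(t) = 60t(1−t)(1−2t)` on `[0,1]`, `0` outside. -/
def fpSmoothstep2 (t : ℝ) : ℝ :=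
  if t ≤ 0 then 0 else if 1 ≤ t then 0 else 60 * t * (1 - t) * (1 - 2 * t)

/-- `S = 0` on `t ≤ 0`. -/
theorem fpSmoothstep_of_nonpos {t : ℝ} (h : t ≤ 0) : fpSmoothstep t = 0 := by simp [fpSmoothstep, h]
/-- `S = 1` on `t ≥ 1`. -/
theorem fpSmoothstep_of_one_le {t : ℝ} (h : 1 ≤ t) : fpSmoothstep t = 1 := by
  unfold fpSmoothstep
  by_cases h0 : t ≤ 0
  · exfalso; linarith
  · simp [h0, h]
/-- `S = t³(10 − 15t + 6t²)` on `[0,1]`. -/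
theorem fpSmoothstep_of_mem {t : ℝ} (h0 : 0 ≤ t) (h1 : t ≤ 1) : fpSmoothstep t = t ^ 3 * (10 - 15 * t + 6 * t ^ 2) := by
  unfold fpSmoothstep
  by_cases ha : t ≤ 0
  · have : t = 0 := le_antisymm ha h0
    subst this; simp
  · by_cases hb : 1 ≤ t
    · have : t = 1 := le_antisymm h1 hb
      subst this; norm_num
    · simp [ha, hb]
/-- `S₁ = 0` on `t ≤ 0`. -/
theorem fpSmoothstep1_of_nonpos {t : ℝ} (h : t ≤ 0) : fpSmoothstep1 t = 0 := by simp [fpSmoothstep1, h]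
/-- `S₁ = 0` on `t ≥ 1`. -/
theorem fpSmoothstep1_of_one_le {t : ℝ} (h : 1 ≤ t) : fpSmoothstep1 t = 0 := by
  unfold fpSmoothstep1
  by_cases h0 : t ≤ 0
  · simp [h0]
  · simp [h0, h]
/-- `S₁ = 30t²(1−t)²` on `[0,1]`. -/
theorem fpSmoothstep1_of_mem {t : ℝ} (h0 : 0 ≤ t) (h1 : t ≤ 1) : fpSmoothstep1 t = 30 * t ^ 2 * (1 - t) ^ 2 := by
  unfold fpSmoothstep1
  by_cases ha : t ≤ 0
  · have : t = 0 := le_antisymm ha h0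
    subst this; simp
  · by_cases hb : 1 ≤ t
    · have : t = 1 := le_antisymm h1 hb
      subst this; norm_num
    · simp [ha, hb]
/-- `S₂ = 0` on `t ≤ 0`. -/
theorem fpSmoothstep2_of_nonpos {t : ℝ} (h : t ≤ 0) : fpSmoothstep2 t = 0 := by simp [fpSmoothstep2, h]
/-- `S₂ = 0` on `t ≥ 1`. -/
theorem fpSmoothstep2_of_one_le {t : ℝ} (h : 1 ≤ t) : fpSmoothstep2 t = 0 := by
  unfold fpSmoothstep2
  by_cases h0 : t ≤ 0
  · simp [h0]
  · simp [h0, h]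
/-- `S₂ = 60t(1−t)(1−2t)` on `[0,1]`. -/
theorem fpSmoothstep2_of_mem {t : ℝ} (h0 : 0 ≤ t) (h1 : t ≤ 1) : fpSmoothstep2 t = 60 * t * (1 - t) * (1 - 2 * t) := by
  unfold fpSmoothstep2
  by_cases ha : t ≤ 0
  · have : t = 0 := le_antisymm ha h0
    subst this; simp
  · by_cases hb : 1 ≤ t
    · have : t = 1 := le_antisymm h1 hb
      subst this; norm_num
    · simp [ha, hb]

/-- The interior polynomial `t³(10 − 15t + 6t²)` has derivative `30t²(1−t)²`. -/
theorem hasDerivAt_quintic (t : ℝ) :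
    HasDerivAt (fun t : ℝ => t ^ 3 * (10 - 15 * t + 6 * t ^ 2)) (30 * t ^ 2 * (1 - t) ^ 2) t := by
  have h3 := hasDerivAt_pow 3 t
  have h4 := hasDerivAt_pow 4 t
  have h5 := hasDerivAt_pow 5 t
  have h : HasDerivAt (fun t : ℝ => 10 * t ^ 3 - 15 * t ^ 4 + 6 * t ^ 5)
      (10 * (((3 : ℕ) : ℝ) * t ^ (3 - 1)) - 15 * (((4 : ℕ) : ℝ) * t ^ (4 - 1)) + 6 * (((5 : ℕ) : ℝ) * t ^ (5 - 1))) t :=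
    ((h3.const_mul 10).sub (h4.const_mul 15)).add (h5.const_mul 6)
  have h' := h.congr_deriv (show _ = 30 * t ^ 2 * (1 - t) ^ 2 by push_cast; ring)
  exact h'.congr_of_eventuallyEq (Filter.Eventually.of_forall fun s => by beta_reduce; ring)

/-- `30t²(1−t)²` has derivative `60t(1−t)(1−2t)`. -/
theorem hasDerivAt_quartic (t : ℝ) :
    HasDerivAt (fun t : ℝ => 30 * t ^ 2 * (1 - t) ^ 2) (60 * t * (1 - t) * (1 - 2 * t)) t := by
  have h2 := hasDerivAt_pow 2 t
  have h3 := hasDerivAt_pow 3 t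
  have h4 := hasDerivAt_pow 4 t
  have h : HasDerivAt (fun t : ℝ => 30 * t ^ 2 - 60 * t ^ 3 + 30 * t ^ 4)
      (30 * (((2 : ℕ) : ℝ) * t ^ (2 - 1)) - 60 * (((3 : ℕ) : ℝ) * t ^ (3 - 1)) + 30 * (((4 : ℕ) : ℝ) * t ^ (4 - 1))) t :=
    ((h2.const_mul 30).sub (h3.const_mul 60)).add (h4.const_mul 30)
  have h' := h.congr_deriv (show _ = 60 * t * (1 - t) * (1 - 2 * t) by push_cast; ring)
  exact h'.congr_of_eventuallyEq (Filter.Eventually.of_forall fun s => by beta_reduce; ring)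

/-- `S′ = S₁` everywhere (gluing at `0` and `1` by one-sided derivatives). -/
theorem hasDerivAt_fpSmoothstep (t : ℝ) : HasDerivAt fpSmoothstep (fpSmoothstep1 t) t := by
  rcases lt_trichotomy t 0 with ht | rfl | ht
  · -- t < 0: locally zero
    have hev : fpSmoothstep =ᶠ[𝓝 t] fun _ => (0:ℝ) := by
      filter_upwards [Iio_mem_nhds ht] with s hs using fpSmoothstep_of_nonpos (le_of_lt hs)
    rw [fpSmoothstep1_of_nonpos ht.le]
    exact (hasDerivAt_const t (0:ℝ)).congr_of_eventuallyEq hev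
  · -- t = 0: glue
    rw [fpSmoothstep1_of_nonpos le_rfl]
    have hL : HasDerivWithinAt fpSmoothstep 0 (Iic 0) 0 := by
      have hev : fpSmoothstep =ᶠ[𝓝[Iic 0] 0] fun _ => (0:ℝ) :=
        eventually_nhdsWithin_of_forall fun s hs => fpSmoothstep_of_nonpos hs
      exact ((hasDerivAt_const (0:ℝ) (0:ℝ)).hasDerivWithinAt).congr_of_eventuallyEq hev (by simp [fpSmoothstep])
    have hR : HasDerivWithinAt fpSmoothstep 0 (Ici 0) 0 := by
      have hq := (hasDerivAt_quintic 0).hasDerivWithinAt (s := Ici 0)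
      have h0 : (30 * (0:ℝ) ^ 2 * (1 - 0) ^ 2) = 0 := by norm_num
      rw [h0] at hq
      have hev : fpSmoothstep =ᶠ[𝓝[Ici 0] 0] fun t : ℝ => t ^ 3 * (10 - 15 * t + 6 * t ^ 2) := by
        have hm : Ico (0:ℝ) 1 ∈ 𝓝[Ici 0] (0:ℝ) := Ico_mem_nhdsGE (by norm_num)
        filter_upwards [hm] with s hs using fpSmoothstep_of_mem hs.1 hs.2.le
      exact hq.congr_of_eventuallyEq hev (by simp [fpSmoothstep])
    have h := hL.union hR
    rwa [Iic_union_Ici, hasDerivWithinAt_univ] at h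
  · rcases lt_trichotomy t 1 with ht1 | rfl | ht1
    · -- 0 < t < 1: interior polynomial
      have hev : fpSmoothstep =ᶠ[𝓝 t] fun t : ℝ => t ^ 3 * (10 - 15 * t + 6 * t ^ 2) := by
        filter_upwards [Ioo_mem_nhds ht ht1] with s hs using fpSmoothstep_of_mem hs.1.le hs.2.le
      rw [fpSmoothstep1_of_mem ht.le ht1.le]
      exact (hasDerivAt_quintic t).congr_of_eventuallyEq hev
    · -- t = 1: glue
      rw [fpSmoothstep1_of_one_le le_rfl]
      have hR : HasDerivWithinAt fpSmoothstep 0 (Ici 1) 1 := by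
        have hev : fpSmoothstep =ᶠ[𝓝[Ici 1] 1] fun _ => (1:ℝ) :=
          eventually_nhdsWithin_of_forall fun s hs => fpSmoothstep_of_one_le hs
        exact ((hasDerivAt_const (1:ℝ) (1:ℝ)).hasDerivWithinAt).congr_of_eventuallyEq hev (by simp [fpSmoothstep])
      have hL : HasDerivWithinAt fpSmoothstep 0 (Iic 1) 1 := by
        have hq := (hasDerivAt_quintic 1).hasDerivWithinAt (s := Iic 1)
        have h0 : (30 * (1:ℝ) ^ 2 * (1 - 1) ^ 2) = 0 := by norm_num
        rw [h0] at hq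
        have hev : fpSmoothstep =ᶠ[𝓝[Iic 1] 1] fun t : ℝ => t ^ 3 * (10 - 15 * t + 6 * t ^ 2) := by
          have hm : Ioc (0:ℝ) 1 ∈ 𝓝[Iic 1] (1:ℝ) := Ioc_mem_nhdsLE (by norm_num)
          filter_upwards [hm] with s hs using fpSmoothstep_of_mem hs.1.le hs.2
        exact hq.congr_of_eventuallyEq hev (by rw [fpSmoothstep_of_one_le le_rfl]; norm_num)
      have h := hL.union hR
      rwa [Iic_union_Ici, hasDerivWithinAt_univ] at h
    · -- t > 1
      have hev : fpSmoothstep =ᶠ[𝓝 t] fun _ => (1:ℝ) := by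
        filter_upwards [Ioi_mem_nhds ht1] with s hs using fpSmoothstep_of_one_le (le_of_lt hs)
      rw [fpSmoothstep1_of_one_le ht1.le]
      exact (hasDerivAt_const t (1:ℝ)).congr_of_eventuallyEq hev

/-- `S₁′ = S₂` everywhere. -/
theorem hasDerivAt_fpSmoothstep1 (t : ℝ) : HasDerivAt fpSmoothstep1 (fpSmoothstep2 t) t := by
  rcases lt_trichotomy t 0 with ht | rfl | ht
  · have hev : fpSmoothstep1 =ᶠ[𝓝 t] fun _ => (0:ℝ) := by
      filter_upwards [Iio_mem_nhds ht] with s hs using fpSmoothstep1_of_nonpos (le_of_lt hs)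
    rw [fpSmoothstep2_of_nonpos ht.le]
    exact (hasDerivAt_const t (0:ℝ)).congr_of_eventuallyEq hev
  · rw [fpSmoothstep2_of_nonpos le_rfl]
    have hL : HasDerivWithinAt fpSmoothstep1 0 (Iic 0) 0 := by
      have hev : fpSmoothstep1 =ᶠ[𝓝[Iic 0] 0] fun _ => (0:ℝ) :=
        eventually_nhdsWithin_of_forall fun s hs => fpSmoothstep1_of_nonpos hs
      exact ((hasDerivAt_const (0:ℝ) (0:ℝ)).hasDerivWithinAt).congr_of_eventuallyEq hev (by simp [fpSmoothstep1])
    have hR : HasDerivWithinAt fpSmoothstep1 0 (Ici 0) 0 := by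
      have hq := (hasDerivAt_quartic 0).hasDerivWithinAt (s := Ici 0)
      have h0 : (60 * (0:ℝ) * (1 - 0) * (1 - 2 * 0)) = 0 := by norm_num
      rw [h0] at hq
      have hev : fpSmoothstep1 =ᶠ[𝓝[Ici 0] 0] fun t : ℝ => 30 * t ^ 2 * (1 - t) ^ 2 := by
        have hm : Ico (0:ℝ) 1 ∈ 𝓝[Ici 0] (0:ℝ) := Ico_mem_nhdsGE (by norm_num)
        filter_upwards [hm] with s hs using fpSmoothstep1_of_mem hs.1 hs.2.le
      exact hq.congr_of_eventuallyEq hev (by simp [fpSmoothstep1])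
    have h := hL.union hR
    rwa [Iic_union_Ici, hasDerivWithinAt_univ] at h
  · rcases lt_trichotomy t 1 with ht1 | rfl | ht1
    · have hev : fpSmoothstep1 =ᶠ[𝓝 t] fun t : ℝ => 30 * t ^ 2 * (1 - t) ^ 2 := by
        filter_upwards [Ioo_mem_nhds ht ht1] with s hs using fpSmoothstep1_of_mem hs.1.le hs.2.le
      rw [fpSmoothstep2_of_mem ht.le ht1.le]
      exact (hasDerivAt_quartic t).congr_of_eventuallyEq hev
    · rw [fpSmoothstep2_of_one_le le_rfl]
      have hR : HasDerivWithinAt fpSmoothstep1 0 (Ici 1) 1 := by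
        have hev : fpSmoothstep1 =ᶠ[𝓝[Ici 1] 1] fun _ => (0:ℝ) :=
          eventually_nhdsWithin_of_forall fun s hs => fpSmoothstep1_of_one_le hs
        exact ((hasDerivAt_const (1:ℝ) (0:ℝ)).hasDerivWithinAt).congr_of_eventuallyEq hev (by simp [fpSmoothstep1])
      have hL : HasDerivWithinAt fpSmoothstep1 0 (Iic 1) 1 := by
        have hq := (hasDerivAt_quartic 1).hasDerivWithinAt (s := Iic 1)
        have h0 : (60 * (1:ℝ) * (1 - 1) * (1 - 2 * 1)) = 0 := by norm_num
        rw [h0] at hq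
        have hev : fpSmoothstep1 =ᶠ[𝓝[Iic 1] 1] fun t : ℝ => 30 * t ^ 2 * (1 - t) ^ 2 := by
          have hm : Ioc (0:ℝ) 1 ∈ 𝓝[Iic 1] (1:ℝ) := Ioc_mem_nhdsLE (by norm_num)
          filter_upwards [hm] with s hs using fpSmoothstep1_of_mem hs.1.le hs.2
        exact hq.congr_of_eventuallyEq hev (by rw [fpSmoothstep1_of_one_le le_rfl]; norm_num)
      have h := hL.union hR
      rwa [Iic_union_Ici, hasDerivWithinAt_univ] at h
    · have hev : fpSmoothstep1 =ᶠ[𝓝 t] fun _ => (0:ℝ) := by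
        filter_upwards [Ioi_mem_nhds ht1] with s hs using fpSmoothstep1_of_one_le (le_of_lt hs)
      rw [fpSmoothstep2_of_one_le ht1.le]
      exact (hasDerivAt_const t (0:ℝ)).congr_of_eventuallyEq hev

/-- `S₂` is continuous (the pieces agree at `0` and `1`). -/
theorem continuous_fpSmoothstep2 : Continuous fpSmoothstep2 := by
  have hq : Continuous fun t : ℝ => 60 * t * (1 - t) * (1 - 2 * t) := by fun_prop
  have hinner : Continuous fun t : ℝ => if 1 ≤ t then (0:ℝ) else 60 * t * (1 - t) * (1 - 2 * t) :=
    Continuous.if_le continuous_const hq continuous_const continuous_id (fun x hx => by rw [← hx]; norm_num)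
  have h : Continuous fun t : ℝ => if t ≤ 0 then (0:ℝ) else if 1 ≤ t then (0:ℝ) else 60 * t * (1 - t) * (1 - 2 * t) :=
    Continuous.if_le continuous_const hinner continuous_id continuous_const (fun x hx => by rw [hx]; norm_num)
  exact h

/-- `deriv S = S₁`. -/
theorem deriv_fpSmoothstep : deriv fpSmoothstep = fpSmoothstep1 := funext fun t => (hasDerivAt_fpSmoothstep t).deriv
/-- `deriv S₁ = S₂`. -/
theorem deriv_fpSmoothstep1 : deriv fpSmoothstep1 = fpSmoothstep2 := funext fun t => (hasDerivAt_fpSmoothstep1 t).deriv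

/-- **The glued quintic smoothstep is `C²`.** -/
theorem contDiff_two_fpSmoothstep : ContDiff ℝ 2 fpSmoothstep := by
  have hd0 : Differentiable ℝ fpSmoothstep := fun t => (hasDerivAt_fpSmoothstep t).differentiableAt
  have hd1 : Differentiable ℝ fpSmoothstep1 := fun t => (hasDerivAt_fpSmoothstep1 t).differentiableAt
  have h1 : ContDiff ℝ 1 fpSmoothstep1 := by
    rw [show (1 : WithTop ℕ∞) = 0 + 1 from (zero_add 1).symm, contDiff_succ_iff_deriv]
    refine ⟨hd1, by simp, ?_⟩
    rw [deriv_fpSmoothstep1]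
    exact contDiff_zero.2 continuous_fpSmoothstep2
  rw [show (2 : WithTop ℕ∞) = 1 + 1 from one_add_one_eq_two.symm, contDiff_succ_iff_deriv]
  refine ⟨hd0, by simp, ?_⟩
  rw [deriv_fpSmoothstep]
  exact h1

/-! ## The split weight `χ(x) = S((|x|² − S₁)/(S₂ − S₁))` of the certificate-form near ledger -/

/-- The near/far split weight of the certificate-form ledger (`nearcert.py` `chi_of_s`): `χ(x) = S((|x|² − S₁)/(S₂ − S₁))`,
`S₁ = R₁²`, `S₂ = R₂²`; the far theorems are weighted by `χ²`, the near ledger by `1 − χ²`. -/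
def fpChi (S1 S2 : ℝ) (x : Fin 3 → ℝ) : ℝ := fpSmoothstep ((fpSq x - S1) / (S2 - S1))

/-- The radial profile `g(s) = S((s − S₁)/(S₂ − S₁))` of `fpChi`. -/
theorem fpChi_eq (S1 S2 : ℝ) (x : Fin 3 → ℝ) :
    fpChi S1 S2 x = (fun s => fpSmoothstep ((s - S1) / (S2 - S1))) (fpSq x) := rfl

/-- `|·|²` is smooth. -/
theorem contDiff_fpSq {n : WithTop ℕ∞} : ContDiff ℝ n fpSq := by
  have h : ContDiff ℝ n (fun y : Fin 3 → ℝ => y 0 ^ 2 + y 1 ^ 2 + y 2 ^ 2) := by fun_prop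
  exact h

/-- The profile is differentiable with `g′(s) = S₁((s − S₁)/(S₂ − S₁))/(S₂ − S₁)` (the ledger's `dchi/ds`). -/
theorem hasDerivAt_fpChi_profile (S1 S2 s : ℝ) :
    HasDerivAt (fun s => fpSmoothstep ((s - S1) / (S2 - S1))) (fpSmoothstep1 ((s - S1) / (S2 - S1)) / (S2 - S1)) s := by
  have hlin : HasDerivAt (fun s : ℝ => (s - S1) / (S2 - S1)) (1 / (S2 - S1)) s := by
    have h := ((hasDerivAt_id s).sub_const S1).div_const (S2 - S1)
    simpa using h
  have h := (hasDerivAt_fpSmoothstep ((s - S1) / (S2 - S1))).comp s hlin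
  have h' : HasDerivAt (fun s => fpSmoothstep ((s - S1) / (S2 - S1))) (fpSmoothstep1 ((s - S1) / (S2 - S1)) * (1 / (S2 - S1))) s := h
  exact h'.congr_deriv (by ring)

/-- **The split weight is `C²`.** -/
theorem contDiff_two_fpChi (S1 S2 : ℝ) : ContDiff ℝ 2 (fpChi S1 S2) := by
  have h : ContDiff ℝ 2 (fun x : Fin 3 → ℝ => (fpSq x - S1) / (S2 - S1)) := (contDiff_fpSq.sub contDiff_const).div_const _
  exact contDiff_two_fpSmoothstep.comp h

/-- `χ = 0` on the inner ball `|x|² ≤ S₁`. -/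
theorem fpChi_eq_zero {S1 S2 : ℝ} (hlt : S1 < S2) {x : Fin 3 → ℝ} (hx : fpSq x ≤ S1) : fpChi S1 S2 x = 0 :=
  fpSmoothstep_of_nonpos (div_nonpos_of_nonpos_of_nonneg (by linarith) (by linarith))

/-- `χ = 1` outside `|x|² ≥ S₂`. -/
theorem fpChi_eq_one {S1 S2 : ℝ} (hlt : S1 < S2) {x : Fin 3 → ℝ} (hx : S2 ≤ fpSq x) : fpChi S1 S2 x = 1 :=
  fpSmoothstep_of_one_le ((one_le_div (by linarith)).2 (by linarith))

/-- **`0 ∉ tsupport χ`** (`χ` vanishes on the open ball `|x|² < S₁ ∋ 0`). -/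
theorem zero_notMem_tsupport_fpChi {S1 S2 : ℝ} (h1 : 0 < S1) (hlt : S1 < S2) : (0 : Fin 3 → ℝ) ∉ tsupport (fpChi S1 S2) := by
  rw [notMem_tsupport_iff_eventuallyEq]
  have hopen : IsOpen {x : Fin 3 → ℝ | fpSq x < S1} := isOpen_lt continuous_fpSq continuous_const
  have h0 : (0 : Fin 3 → ℝ) ∈ {x : Fin 3 → ℝ | fpSq x < S1} := by simpa [fpSq] using h1
  filter_upwards [hopen.mem_nhds h0] with x hx
  exact fpChi_eq_zero hlt (le_of_lt hx)

/-- **`χ = 1` for `‖y‖ ≥ R`** whenever `S₂ ≤ R²` (sup norm: `‖y‖² ≤ |y|²`). -/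
theorem fpChi_eq_one_of_norm_ge {S1 S2 R : ℝ} (hlt : S1 < S2) (hR : 0 ≤ R) (hS2 : S2 ≤ R ^ 2) (y : Fin 3 → ℝ)
    (hy : R ≤ ‖y‖) : fpChi S1 S2 y = 1 := by
  have h1 : R ^ 2 ≤ ‖y‖ ^ 2 := pow_le_pow_left₀ hR hy 2
  exact fpChi_eq_one hlt (hS2.trans (h1.trans (norm_sq_le_fpSq y)))

/-- The gradient of the split weight: `∂ⱼχ(x) = 2xⱼ·S₁(t)/(S₂ − S₁)`, `t = (|x|² − S₁)/(S₂ − S₁)`. -/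
theorem fpGradS_fpChi (S1 S2 : ℝ) (x : Fin 3 → ℝ) (j : Fin 3) :
    fpGradS (fpChi S1 S2) x j = 2 * x j * (fpSmoothstep1 ((fpSq x - S1) / (S2 - S1)) / (S2 - S1)) := by
  have h := fpGradS_radial (g := fun s => fpSmoothstep ((s - S1) / (S2 - S1))) (x := x)
    (hasDerivAt_fpChi_profile S1 S2 (fpSq x)).differentiableAt j
  rw [(hasDerivAt_fpChi_profile S1 S2 (fpSq x)).deriv] at h
  exact h

/-- **The interface density of the generic flux against the ledger's weight**:
`2χ⟪∇χ, Φ⟫ = 4χ·χ′·[a·s⁻³|v|² + (b+c)·s⁻⁴⟪x,v⟫² + n·s⁻³(vᵀ(∇v)x − (div v)⟪x,v⟫)]` with `χ′ = dχ/ds = S₁(t)/(S₂ − S₁)` —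
term by term the `flux1/flux2/flux3` entries (`coef = 4χ·dχ/ds`, channels `FLUX_A, FLUX_BC, FLUX_N`) of `nearcert.py`/`boxnear.py`.
NOT a proof of H12⋆, NOT summit progress. -/
theorem two_chi_fpFlux4DotGrad_fpChi (S1 S2 a b c n : ℝ) (v : (Fin 3 → ℝ) → (Fin 3 → ℝ)) (x : Fin 3 → ℝ) :
    2 * fpChi S1 S2 x * fpFlux4DotGrad a b c n v (fpChi S1 S2) x =
      4 * fpChi S1 S2 x * (fpSmoothstep1 ((fpSq x - S1) / (S2 - S1)) / (S2 - S1)) *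
        (a * ((fpSq x)⁻¹ ^ 3 * fpSq (v x)) + (b + c) * ((fpSq x)⁻¹ ^ 4 * fpDot x (v x) ^ 2) +
          n * ((fpSq x)⁻¹ ^ 3 * (fpVGX x (v x) (fpGrad v x) - fpTr (fpGrad v x) * fpDot x (v x)))) := by
  have h := two_chi_fpFlux4DotGrad_radial (g := fun s => fpSmoothstep ((s - S1) / (S2 - S1))) (x := x)
    (hasDerivAt_fpChi_profile S1 S2 (fpSq x)).differentiableAt a b c n v
  rw [(hasDerivAt_fpChi_profile S1 S2 (fpSq x)).deriv] at h
  exact h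

/-! ## The far half for certificate D with the ledger's weight -/

/-- **Certificate D on the P1 class with the ledger's split weight** `χ = fpChi R₁² R₂²` (`0 < R₁ < R₂`): for `v` `K`-Lipschitz, locally
affine off a null set and affine for `‖y‖ ≥ R`,
`∫ χ²·N(7/4,7/4,6/5,9/10)(v) ≤ (9/40)·∫ χ²·Den(v) + ∫ 2χ⟪∇χ, Φ_D(v)⟫` — all weight hypotheses discharged.
NOT a proof of H12⋆, NOT summit progress. -/
theorem farPencilD_weighted_integral_le_fpChi {v : (Fin 3 → ℝ) → (Fin 3 → ℝ)} {K : ℝ≥0} {R R1 R2 : ℝ}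
    {b₀ : Fin 3 → ℝ} {A : Fin 3 → Fin 3 → ℝ} {S : Set (Fin 3 → ℝ)} (hR1 : 0 < R1) (hR12 : R1 < R2)
    (hv : LipschitzWith K v) (hS : volume S = 0)
    (hloc : ∀ x, x ∉ S → ∃ r > 0, ∃ L : (Fin 3 → ℝ) →L[ℝ] (Fin 3 → ℝ), ∀ y ∈ ball x r, v y = v x + L (y - x))
    (htail : ∀ y : Fin 3 → ℝ, R ≤ ‖y‖ → ∀ j, v y j = b₀ j + (y 0 * A 0 j + y 1 * A 1 j + y 2 * A 2 j)) :
    ∫ x, fpChi (R1 ^ 2) (R2 ^ 2) x ^ 2 * fpNumI (7 / 4) (7 / 4) (6 / 5) (9 / 10) x (v x) (fpGrad v x) ≤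
      9 / 40 * (∫ x, fpChi (R1 ^ 2) (R2 ^ 2) x ^ 2 * fpDen x (fpGrad v x)) +
        ∫ x, 2 * fpChi (R1 ^ 2) (R2 ^ 2) x *
          fpFlux4DotGrad (7 / 45) (23 / 30) (-(19 / 40)) (3 / 40) v (fpChi (R1 ^ 2) (R2 ^ 2)) x := by
  have hlt : R1 ^ 2 < R2 ^ 2 := by nlinarith
  have hR2 : 0 ≤ R2 := by linarith
  have htail' : ∀ y : Fin 3 → ℝ, max R R2 ≤ ‖y‖ → ∀ j, v y j = b₀ j + (y 0 * A 0 j + y 1 * A 1 j + y 2 * A 2 j) :=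
    fun y hy j => htail y ((le_max_left _ _).trans hy) j
  have hχ1 : ∀ y : Fin 3 → ℝ, max R R2 ≤ ‖y‖ → fpChi (R1 ^ 2) (R2 ^ 2) y = 1 :=
    fun y hy => fpChi_eq_one_of_norm_ge hlt hR2 le_rfl y ((le_max_right _ _).trans hy)
  exact farPencilD_weighted_integral_le_of_locallyAffine hv hS hloc (contDiff_two_fpChi _ _)
    (zero_notMem_tsupport_fpChi (by positivity) hlt) htail' hχ1

end Summit.AtomisticToContinuum.Crystallization.Theorems.StrictSplittingRuleBirth
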